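import Literature.NumberTheory.EllipticCurves.PastenEigenSystemCountProofs
import Literature.NumberTheory.EllipticCurves.PastenCongruenceModulusSizeProofs
import Summits.ABC.ABC.Theorems.IsogenyGlueCongruenceSemistableHeightPolyBoundHeckeBound
import HarnessLib

/-!
# Crux A `DegreePrimesPolyBounded` (stmt-ABC-2045), line `newpart-congruence-friability` —
# realization of every system of Hecke eigenvalues by an Atkin–Lehner eigenform

Support file for the E-free bet `stub_gradedNewPartFriability` of the line (second lead, unit
`line-stmt-ABC-2045-c1`).  The bet and its calibration speak about ALL complex points of
`Spec 𝕋`, `𝕋 = anemicHeckeRing N k = ℤ[T_p : p ∤ N]` — the Galois conjugates `σ ∘ χ_f` of the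
system of a newform `f` included — while the tree's distinguishing/Sturm machinery speaks about
FORMS.  This file closes that gap (Pasten 2024, §4.9–4.11: `𝕋 ⊗ ℂ ≅ ∏_χ ℂ` over the systems of
Hecke eigenvalues occurring in `S_k(Γ₀(N))`; the tree had only the inequality
`rank_ℤ 𝕋 ≤ #{systems}`, `finrank_anemicHeckeRing_le_card_systems`):

* `card_ringHom_le_finrank` — a commutative ring `O`, free of finite rank `d` over `ℤ`, has at
  most `d` ring maps to `ℂ` (Dedekind's independence of characters + evaluation on a `ℤ`-basis);
* `ker_ringHom_mem_minimalPrimes` — the kernel of every ring map `𝕋 → ℂ` is a minimal prime;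
* `exists_ringHom_apply_eq_of_isRoot_charpoly_lmul` — every complex root of the characteristic
  polynomial of multiplication by `x` on such an `O` is a value `ψ(x)` of a ring map `ψ : O → ℂ`
  (the complexification `ℂ ⊗ O` modulo a maximal ideal over the eigenvalue);
* `exists_anemicEigenvalue_eq_of_ringHom` — **every ring map `ψ : 𝕋 → ℂ` is the system of
  Hecke eigenvalues of a member `[α_d]_k g` of the Atkin–Lehner eigenbasis** (`g` a newform of a
  level `M ∣ N`): counting, `Σ_P rank(𝕋 ⧸ P) ≤ rank 𝕋 ≤ #{systems}` (tree) against
  `#{systems with kernel P} ≤ rank(𝕋 ⧸ P)` (first bullet).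

## References

* [PastenShimura2024] H. Pasten, *Shimura curves and the abc conjecture*, J. Number Theory 254
  (2024) 214–335, §4.9–4.11 p. 16.
* [DiamondShurman2005] F. Diamond, J. Shurman, *A first course in modular forms*, Thm. 5.8.3.
-/

noncomputable section

open scoped MatrixGroups ModularForm TensorProduct
open CongruenceSubgroup UpperHalfPlane Polynomial

-- `Summit.<Summit>.<Problem>` is the mandated summit-side namespace (CONVENTIONS §2); for the
-- single-conjunct summit `ABC` the two coincide, so the duplicate `ABC.ABC` is deliberate.
set_option linter.dupNamespace false

namespace Summit.ABC.ABC.Theorems.DegreePrimesPolyBounded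

open Literature.NumberTheory.EllipticCurves.ModularForms

/-! ### Ring maps to `ℂ` from a ring free of finite rank over `ℤ` -/

/-- **At most `rank_ℤ O` ring maps `O → ℂ`.** For a commutative ring `O` which is a free
`ℤ`-module of finite rank, every finite set of ring maps `O → ℂ` has at most `rank_ℤ O` members:
distinct ring maps are `ℂ`-linearly independent functions (Dedekind), they are additive, and an
additive map vanishing on a `ℤ`-basis vanishes, so evaluation on a `ℤ`-basis embeds their span
into `ℂ^{rank}`. [folklore] -/
theorem card_ringHom_le_finrank {O : Type*} [CommRing O] [Module.Free ℤ O] [Module.Finite ℤ O]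
    (F : Finset (O →+* ℂ)) : F.card ≤ Module.finrank ℤ O := by
  classical
  have hDed := linearIndependent_monoidHom O ℂ
  let ι : F → (O →* ℂ) := fun ψ ↦ (ψ.1 : O →* ℂ)
  have hι : Function.Injective ι := by
    intro a b h
    apply Subtype.ext
    exact RingHom.ext fun x ↦ by
      have := congrArg (fun m : O →* ℂ ↦ m x) h
      simpa [ι] using this
  have hli : LinearIndependent ℂ (fun ψ : F ↦ ((ψ.1 : O →* ℂ) : O → ℂ)) := hDed.comp ι hι
  let b := Module.Free.chooseBasis ℤ O
  let L : (O → ℂ) →ₗ[ℂ] (Module.Free.ChooseBasisIndex ℤ O → ℂ) :=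
    { toFun := fun g i ↦ g (b i)
      map_add' := fun g h ↦ rfl
      map_smul' := fun c g ↦ rfl }
  have hadd : ∀ g ∈ Submodule.span ℂ (Set.range fun ψ : F ↦ ((ψ.1 : O →* ℂ) : O → ℂ)),
      ∃ A : O →+ ℂ, (A : O → ℂ) = g := by
    intro g hg
    refine Submodule.span_induction ?_ ?_ ?_ ?_ hg
    · rintro _ ⟨ψ, rfl⟩
      exact ⟨ψ.1.toAddMonoidHom, rfl⟩
    · exact ⟨0, rfl⟩
    · rintro g h - - ⟨A, rfl⟩ ⟨B, rfl⟩
      exact ⟨A + B, rfl⟩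
    · rintro c g - ⟨A, rfl⟩
      refine ⟨(DistribSMul.toAddMonoidHom ℂ c).comp A, ?_⟩
      ext x
      simp
  have hdisj : Disjoint (Submodule.span ℂ (Set.range fun ψ : F ↦ ((ψ.1 : O →* ℂ) : O → ℂ)))
      (LinearMap.ker L) := by
    rw [Submodule.disjoint_def]
    intro g hg hker
    obtain ⟨A, rfl⟩ := hadd g hg
    have hb : ∀ i, A (b i) = 0 := fun i ↦ by
      have := congrFun (LinearMap.mem_ker.mp hker) i
      simpa [L] using this
    have hA : A.toIntLinearMap = 0 := b.ext fun i ↦ by simpa using hb i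
    ext x
    have := congrArg (fun f : O →ₗ[ℤ] ℂ ↦ f x) hA
    simpa using this
  have h := (hli.map hdisj).fintype_card_le_finrank
  rwa [Fintype.card_coe, Module.finrank_fintype_fun_eq_card,
    ← Module.finrank_eq_card_chooseBasisIndex] at h

/-- **At most `rank_ℤ(R ⧸ P)` ring maps `R → ℂ` with kernel `P`** (when `R ⧸ P` is free of finite
rank over `ℤ`): they factor injectively through `R ⧸ P` (`card_ringHom_le_finrank`). [folklore] -/
theorem card_ringHom_ker_eq_le_finrank {R : Type*} [CommRing R] (P : Ideal R)
    [Module.Free ℤ (R ⧸ P)] [Module.Finite ℤ (R ⧸ P)] (F : Finset (R →+* ℂ))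
    (hF : ∀ ρ ∈ F, RingHom.ker ρ = P) : F.card ≤ Module.finrank ℤ (R ⧸ P) := by
  classical
  have hle : ∀ ρ ∈ F, ∀ a ∈ P, ρ a = 0 := fun ρ hρ a ha ↦ by
    rw [← RingHom.mem_ker, hF ρ hρ]; exact ha
  let lift : F → (R ⧸ P →+* ℂ) := fun ρ ↦ Ideal.Quotient.lift P ρ.1 (hle ρ.1 ρ.2)
  have hinj : Function.Injective lift := by
    intro a b h
    apply Subtype.ext
    refine RingHom.ext fun x ↦ ?_
    have := congrArg (fun φ : R ⧸ P →+* ℂ ↦ φ (Ideal.Quotient.mk P x)) h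
    simpa [lift] using this
  calc F.card = (Finset.univ.image lift).card := by
        rw [Finset.card_image_of_injective _ hinj, Finset.card_univ, Fintype.card_coe]
    _ ≤ Module.finrank ℤ (R ⧸ P) := card_ringHom_le_finrank _

/-- **A complex root of the characteristic polynomial of multiplication by `x` is a value of `x`
under a ring map to `ℂ`.** For a commutative ring `O`, free of finite rank over `ℤ`, `x ∈ O` and a
complex root `μ` of the characteristic polynomial of `y ↦ x y` on `O`, there is a ring map
`ψ : O → ℂ` with `ψ(x) = μ`: in the complexification `A = ℂ ⊗ O` the element `1 ⊗ x − μ` kills an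
eigenvector (`LinearMap.charpoly_baseChange`), so it is not a unit and lies in a maximal ideal
`𝔑`; `A ⧸ 𝔑` is a finite field extension of `ℂ`, i.e. `ℂ` itself. [folklore] -/
theorem exists_ringHom_apply_eq_of_isRoot_charpoly_lmul {O : Type*} [CommRing O]
    [Module.Free ℤ O] [Module.Finite ℤ O] (x : O) {μ : ℂ}
    (hμ : ((Algebra.lmul ℤ O x).charpoly.map (Int.castRingHom ℂ)).IsRoot μ) :
    ∃ ψ : O →+* ℂ, ψ x = μ := by
  classical
  let A := ℂ ⊗[ℤ] O
  set T : Module.End ℂ A := Algebra.lmul ℂ A (1 ⊗ₜ x) with hT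
  have hchar : T.charpoly = (Algebra.lmul ℤ O x).charpoly.map (Int.castRingHom ℂ) := by
    rw [hT, ← Algebra.baseChange_lmul, LinearMap.charpoly_baseChange]
    rfl
  have hev : Module.End.HasEigenvalue T μ := by
    rw [Module.End.hasEigenvalue_iff_isRoot_charpoly, hchar]
    exact hμ
  obtain ⟨v, hv⟩ := hev.exists_hasEigenvector
  set a : A := 1 ⊗ₜ x - algebraMap ℂ A μ with ha
  have hav : a * v = 0 := by
    have h1 : T v = μ • v := hv.apply_eq_smul
    rw [hT, Algebra.coe_lmul_eq_mul, LinearMap.mul_apply'] at h1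
    rw [ha, sub_mul, h1, Algebra.algebraMap_eq_smul_one, smul_mul_assoc, one_mul, sub_self]
  have hunit : ¬ IsUnit a := by
    intro hu
    obtain ⟨u, hu⟩ := hu
    apply hv.2
    have : (↑u⁻¹ * ↑u : A) * v = 0 := by rw [mul_assoc, hu, hav, mul_zero]
    rwa [Units.inv_mul, one_mul] at this
  obtain ⟨𝔑, h𝔑max, ha𝔑⟩ := Ideal.exists_le_maximal (Ideal.span {a})
    ((Ideal.span_singleton_ne_top) hunit)
  let L := A ⧸ 𝔑
  letI : Field L := Ideal.Quotient.field 𝔑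
  haveI : Algebra.IsIntegral ℂ L := Algebra.IsIntegral.of_finite ℂ L
  let e : ℂ ≃+* L := RingEquiv.ofBijective (algebraMap ℂ L)
    (IsAlgClosed.algebraMap_bijective_of_isIntegral (k := ℂ) (K := L))
  refine ⟨e.symm.toRingHom.comp ((Ideal.Quotient.mk 𝔑).comp
    (Algebra.TensorProduct.includeRight (R := ℤ) (A := ℂ) (B := O)).toRingHom), ?_⟩
  have hq : Ideal.Quotient.mk 𝔑 ((1 : ℂ) ⊗ₜ[ℤ] x) = Ideal.Quotient.mk 𝔑 (algebraMap ℂ A μ) := by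
    rw [Ideal.Quotient.eq, ← ha]
    exact ha𝔑 (Ideal.mem_span_singleton_self a)
  change e.symm (Ideal.Quotient.mk 𝔑 ((1 : ℂ) ⊗ₜ[ℤ] x)) = μ
  rw [hq]
  apply e.injective
  rw [RingEquiv.apply_symm_apply]
  rfl

/-! ### Systems of Hecke eigenvalues: every complex point of `Spec 𝕋` is an eigenform's system -/

variable {N : ℕ} [NeZero N] {k : ℤ}

/-- **The kernel of every ring map `𝕋 → ℂ` is a minimal prime of `𝕋`.**  `P' = ker ψ` is a
prime containing a minimal prime `P₀`; in the domain `𝕋 ⧸ P₀`, module-finite hence integral over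
`ℤ`, the image of `P'` meets `ℤ` in `0` (`ψ(n) = n`), so it is `0` (`Ideal.eq_bot_of_comap_eq_bot`):
`P' = P₀`. [cite: PastenShimura2024, §4.11 p. 16] -/
theorem ker_ringHom_mem_minimalPrimes (ψ : anemicHeckeRing N k →+* ℂ) :
    RingHom.ker ψ ∈ minimalPrimes (anemicHeckeRing N k) := by
  haveI : (RingHom.ker ψ).IsPrime := RingHom.ker_isPrime ψ
  obtain ⟨P₀, hP₀, hle⟩ := Ideal.exists_minimalPrimes_le (show ⊥ ≤ RingHom.ker ψ from bot_le)
  suffices h : RingHom.ker ψ ≤ P₀ by rwa [le_antisymm h hle]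
  haveI : P₀.IsPrime := hP₀.1.1
  haveI : Module.Finite ℤ (anemicHeckeRing N k ⧸ P₀) := finite_quotient_anemicHeckeRing P₀
  have hbot : ((RingHom.ker ψ).map (Ideal.Quotient.mk P₀)).comap
      (algebraMap ℤ (anemicHeckeRing N k ⧸ P₀)) = ⊥ := by
    refine eq_bot_iff.mpr fun n hn ↦ ?_
    rw [Ideal.mem_comap] at hn
    change Ideal.Quotient.mk P₀ (algebraMap ℤ (anemicHeckeRing N k) n) ∈ _ at hn
    rw [Ideal.mem_quotient_iff_mem_sup, sup_eq_left.mpr hle, RingHom.mem_ker, eq_intCast,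
      map_intCast, Int.cast_eq_zero] at hn
    rw [hn]
    exact Ideal.zero_mem _
  have hmap : (RingHom.ker ψ).map (Ideal.Quotient.mk P₀) = ⊥ := Ideal.eq_bot_of_comap_eq_bot hbot
  intro x hx
  rw [← Ideal.Quotient.eq_zero_iff_mem, ← Ideal.mem_bot, ← hmap]
  exact Ideal.mem_map_of_mem _ hx

/-- A ring map `𝕋 → ℂ` vanishing on a minimal prime `P` has kernel exactly `P`. [folklore] -/
theorem ker_eq_of_mem_minimalPrimes_of_le (ψ : anemicHeckeRing N k →+* ℂ)
    {P : Ideal (anemicHeckeRing N k)} (hP : P ∈ minimalPrimes (anemicHeckeRing N k))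
    (hle : P ≤ RingHom.ker ψ) : RingHom.ker ψ = P :=
  le_antisymm ((ker_ringHom_mem_minimalPrimes ψ).2 ⟨hP.1.1, bot_le⟩ hle) hle

/-- The system of eigenvalues of a nonzero simultaneous eigenvector, as a ring map (the tree's
`eigencharacter`), has kernel the eigen-ideal. [folklore] -/
theorem ker_eigencharacter {φ : CuspForm (Gamma0 N) k} (hφ : IsAnemicEigenvector φ) (hφ0 : φ ≠ 0) :
    RingHom.ker (eigencharacter hφ hφ0) = eigenIdeal φ :=
  (eigenIdeal_eq_ker_eigencharacter hφ hφ0).symm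

/-- **Every ring map `ψ : 𝕋 → ℂ` is the system of Hecke eigenvalues of a member of the
Atkin–Lehner eigenbasis** `[α_d]_k g` (`g` a newform of level `M`, `M d ∣ N`), i.e. every
complex point of `Spec 𝕋` is realized in `S_k(Γ₀(N))` (Pasten 2024, §4.9–4.11:
`𝕋 ⊗ ℂ ≅ ∏_χ ℂ` over the systems occurring in `S_k(Γ₀(N))`).  Proof by counting: the systems of
the eigenbasis are ring maps whose kernels are minimal primes; those with kernel `P` number at
most `rank_ℤ(𝕋 ⧸ P)` (`card_ringHom_ker_eq_le_finrank`), and an unrealized `ψ` with kernel `P₀`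
would make the count at `P₀` at most `rank_ℤ(𝕋 ⧸ P₀) − 1`, contradicting
`Σ_P rank_ℤ(𝕋 ⧸ P) ≤ rank_ℤ 𝕋 ≤ #{systems}` (`sum_finrank_quotient_minimalPrimes_le_finrank`,
`finrank_anemicHeckeRing_le_card_systems`). [cite: PastenShimura2024, §4.11 p. 16] -/
theorem exists_anemicEigenvalue_eq_of_ringHom (ψ : anemicHeckeRing N k →+* ℂ) :
    ∃ (x : AtkinLehnerIndex N) (g : CuspForm (Gamma0 x.1.1) k), IsNewform0 g ∧
      degeneracyMap0 x.1.1 N x.1.2 k g ≠ 0 ∧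
      ⇑ψ = anemicEigenvalue (degeneracyMap0 x.1.1 N x.1.2 k g) := by
  classical
  haveI := finite_atkinLehnerIndex N
  haveI : Fintype (AtkinLehnerIndex N) := Fintype.ofFinite _
  haveI : ∀ y : {y : AtkinLehnerIndex N // y.1.2 = 1}, Fintype ↥(newforms0 y.1.1.1 k) :=
    fun y ↦ (finite_newforms0_holds y.1.1.1 k).fintype
  -- the Atkin–Lehner eigenbasis and its systems, as ring maps
  let ALI := (Σ j : (Σ y : {y : AtkinLehnerIndex N // y.1.2 = 1}, ↥(newforms0 y.1.1.1 k)),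
      {x : AtkinLehnerIndex N // x.1.1 = j.1.1.1.1})
  let v : ALI → CuspForm (Gamma0 N) k := fun t ↦ degeneracyMap0 t.1.1.1.1.1 N t.2.1.1.2 k t.1.2.1
  have hev : ∀ t, IsAnemicEigenvector (v t) := isAnemicEigenvector_degeneracyMap0_newforms N k
  have hne : ∀ t, v t ≠ 0 := degeneracyMap0_newforms_ne_zero N k
  let ρ : ALI → (anemicHeckeRing N k →+* ℂ) := fun t ↦ eigencharacter (hev t) (hne t)
  have hρ : ∀ t, ⇑(ρ t) = anemicEigenvalue (v t) := fun t ↦ rfl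
  by_contra hcon
  push Not at hcon
  have hψne : ∀ t, ρ t ≠ ψ := fun t h ↦
    hcon ⟨(t.1.1.1.1.1, t.2.1.1.2), mul_dvd_of_atkinLehnerIndex_fst_eq t.2⟩ t.1.2.1 t.1.2.2 (hne t)
      (by rw [← h]; rfl)
  -- the tree's count: `Σ_P rank(𝕋 ⧸ P) ≤ rank 𝕋 ≤ #systems`
  set s := (finite_minimalPrimes_anemicHeckeRing N k).toFinset with hs
  have hA := sum_finrank_quotient_minimalPrimes_le_finrank (N := N) (k := k)
  let X : Finset (anemicHeckeRing N k → ℂ) := Finset.univ.image fun t ↦ anemicEigenvalue (v t)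
  have hB : Module.finrank ℤ (anemicHeckeRing N k) ≤ X.card :=
    finrank_anemicHeckeRing_le_card_systems _ (linearIndependent_degeneracyMap0_newforms N k)
      (span_degeneracyMap0_newforms_eq_top N k) hev X
      (fun t ↦ Finset.mem_image_of_mem _ (Finset.mem_univ t))
  let X' : Finset (anemicHeckeRing N k →+* ℂ) := Finset.univ.image ρ
  have hXX' : X = X'.image (fun φ : anemicHeckeRing N k →+* ℂ ↦ (⇑φ : anemicHeckeRing N k → ℂ)) := by
    rw [Finset.image_image]
    rfl
  have hX' : X.card = X'.card := by
    rw [hXX', Finset.card_image_of_injective _ DFunLike.coe_injective]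
  -- kernels of all these ring maps are minimal primes
  have hkerX : ∀ φ ∈ insert ψ X', RingHom.ker φ ∈ s := fun φ _ ↦
    (finite_minimalPrimes_anemicHeckeRing N k).mem_toFinset.mpr (ker_ringHom_mem_minimalPrimes φ)
  have hψX : ψ ∉ X' := fun h ↦ by
    obtain ⟨t, -, ht⟩ := Finset.mem_image.mp h
    exact hψne t ht
  -- count fibrewise
  have hcount : (insert ψ X').card = ∑ P ∈ s,
      ((insert ψ X').filter fun φ ↦ RingHom.ker φ = P).card :=
    Finset.card_eq_sum_card_fiberwise hkerX
  have hfib : ∀ P ∈ s, ((insert ψ X').filter fun φ ↦ RingHom.ker φ = P).card ≤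
      Module.finrank ℤ (anemicHeckeRing N k ⧸ P) := by
    intro P hP
    have hP' := (finite_minimalPrimes_anemicHeckeRing N k).mem_toFinset.mp hP
    haveI := free_quotient_of_mem_minimalPrimes hP'
    haveI := finite_quotient_anemicHeckeRing P
    exact card_ringHom_ker_eq_le_finrank P _ fun φ hφ ↦ (Finset.mem_filter.mp hφ).2
  have hle : (insert ψ X').card ≤ Module.finrank ℤ (anemicHeckeRing N k) := by
    rw [hcount]
    exact (Finset.sum_le_sum hfib).trans hA
  rw [Finset.card_insert_of_notMem hψX] at hle
  rw [hX'] at hB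
  omega

/-- **Registered sub-goal `stub_realizationOfEigensystems` (line `newpart-congruence-friability`,
crux stmt-ABC-2045): every complex point of `Spec 𝕋_{N,k}` is realized by an Atkin–Lehner
eigenform** — `exists_anemicEigenvalue_eq_of_ringHom` at every level and weight.
[cite: PastenShimura2024, §4.11 p. 16] -/
theorem stub_realizationOfEigensystems :
    ∀ (N : ℕ) [NeZero N] (k : ℤ) (ψ : anemicHeckeRing N k →+* ℂ),
      ∃ (x : AtkinLehnerIndex N) (g : CuspForm (Gamma0 x.1.1) k), IsNewform0 g ∧
        degeneracyMap0 x.1.1 N x.1.2 k g ≠ 0 ∧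
        ⇑ψ = anemicEigenvalue (degeneracyMap0 x.1.1 N x.1.2 k g) :=
  fun _ _ _ ψ ↦ exists_anemicEigenvalue_eq_of_ringHom ψ

/-- **Every ring map `𝕋 → ℂ` is the system of an Atkin–Lehner form of a newform**, unbundled:
there are `M d ∣ N` and a newform `g` of level `M` with `[α_d]_k g ≠ 0` such that
`ψ(T_p) = a_p(g)` for every prime `p ∤ N` and, more generally, `t · [α_d]_k g = ψ(t) · [α_d]_k g`
for all `t ∈ 𝕋`. [cite: PastenShimura2024, §4.11 p. 16] -/
theorem exists_isNewform0_apply_eq_smul_of_ringHom (ψ : anemicHeckeRing N k →+* ℂ) :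
    ∃ (x : AtkinLehnerIndex N) (g : CuspForm (Gamma0 x.1.1) k), IsNewform0 g ∧
      degeneracyMap0 x.1.1 N x.1.2 k g ≠ 0 ∧
      (∀ t : anemicHeckeRing N k, (t : Module.End ℂ (CuspForm (Gamma0 N) k))
        (degeneracyMap0 x.1.1 N x.1.2 k g) = ψ t • degeneracyMap0 x.1.1 N x.1.2 k g) ∧
      ∀ (p : ℕ) (hp : p.Prime) (hpN : ¬ p ∣ N),
        ψ (@anemicHeckeRing.T N _ k p ⟨hp.ne_zero⟩ hp hpN) = (qExpansion 1 ⇑g).coeff p := by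
  obtain ⟨x, g, hg, hne, hψ⟩ := exists_anemicEigenvalue_eq_of_ringHom ψ
  have hev : IsAnemicEigenvector (degeneracyMap0 x.1.1 N x.1.2 k g) :=
    isAnemicEigenvector_degeneracyMap0 x hg
  refine ⟨x, g, hg, hne, fun t ↦ ?_, fun p hp hpN ↦ ?_⟩
  · rw [hev.apply_eq_smul t, ← hψ]
  · haveI : NeZero p := ⟨hp.ne_zero⟩
    have h1 : ψ (anemicHeckeRing.T N k p hp hpN) =
        anemicEigenvalue (degeneracyMap0 x.1.1 N x.1.2 k g) (anemicHeckeRing.T N k p hp hpN) := by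
      rw [← hψ]
    rw [h1]
    exact anemicEigenvalue_eq_of_apply_eq_smul hev hne
      (by rw [anemicHeckeRing.coe_T]; exact heckeT_degeneracyMap0_eq_coeff_smul x hg p hp hpN)

/-- **Hecke eigenvalue bound for every complex point of `Spec 𝕋` (weight `2`, trivial bound):**
`|ψ(T_p)| ≤ 2p` for every ring map `ψ : 𝕋 → ℂ` and prime `p ∤ N` — `ψ(T_p)` is an eigenvalue of
`T_p` on `S₂(Γ₀(N))` (`exists_isNewform0_apply_eq_smul_of_ringHom`) and
`norm_le_two_mul_of_hasEigenvalue_heckeT_two`. [folklore] -/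
theorem norm_ringHom_T_le_two_mul (ψ : anemicHeckeRing N 2 →+* ℂ) (p : ℕ) (hp : p.Prime)
    (hpN : ¬ p ∣ N) :
    ‖ψ (@anemicHeckeRing.T N _ 2 p ⟨hp.ne_zero⟩ hp hpN)‖ ≤ 2 * p := by
  haveI : NeZero p := ⟨hp.ne_zero⟩
  obtain ⟨x, g, -, hne, hsmul, -⟩ := exists_isNewform0_apply_eq_smul_of_ringHom ψ
  have hev : Module.End.HasEigenvalue (heckeT (Gamma0 N) 2 p)
      (ψ (anemicHeckeRing.T N 2 p hp hpN)) := by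
    refine Module.End.hasEigenvalue_of_hasEigenvector ⟨Module.End.mem_eigenspace_iff.mpr ?_, hne⟩
    rw [← anemicHeckeRing.coe_T N 2 p hp hpN]
    exact hsmul _
  exact Summit.ABC.ABC.Theorems.norm_le_two_mul_of_hasEigenvalue_heckeT_two N p hp hpN _ hev

end Summit.ABC.ABC.Theorems.DegreePrimesPolyBounded

end
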